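import Summits.ResolutionOfSingularities.ResolutionOfSingularities.Theorems.EquisingularLiftEquisingularLiftNatNonCartierFibre
import Literature.AlgebraicGeometry.Resolution.RegularLocalRingsUFD
import Literature.AlgebraicGeometry.Resolution.RegularLocalRingsQuotient
import Mathlib
import HarnessLib

/-!
# [OURS · L1 W4.5(b) · EL♮(3)] E-NEG(1), part 3a (ring core) — an `𝔪`-primary pair in a PRIME HYPERSURFACE of a regular local
# threefold germ is quasi-regular (the Cohen–Macaulay input «hCM» of PLANNER-MEMO-g9-1 v1.1 §1 (c1); crux `EquisingularLiftNatThree` =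
# stmt-ResolutionOfSingularities-20148, parent stmt-20038)

NOT a statement of any manuscript. Helper file of the chain res-L1-w45b (cell `res-hironaka`, rung L, slot W4.5(b)); AI-written, weaker than
expert review; filed `--supports stmt-ResolutionOfSingularities-20148 --as helper`; it closes nothing. Object (O1) E-NEG(1) of res-L1-w45b-plan-1's
PLANNER-MEMO-g9-1, part 3a: the LOCAL ALGEBRA that discharges the conditional input `hloc` of part 2
(`…NatExactShadowSection.range_subset_image_support_of_exactShadow`, p529064): there the quasi-regularity of the restricted centre
`(x̄₁, x̄₂) = ker s · 𝒪_{D♭,q}` was assumed; here it is PROVED from the shape of the germ — `𝒪_{D♭,q} = A ⧸ (g)` for the regular local ring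
`A = 𝒪_{E,q}` of the carrier (dimension `3`) and a prime element `g` (the equation of the prime divisor `D♭ ⊂ E`, Auslander–Buchsbaum) not
divisible by the uniformizer `ϖ` (the special fibre of `D♭` is a curve, not the plane `E_k`) — as soon as `(x̄₁, x̄₂)` is `𝔪`-primary
(«`s(η) ∉ D♭`»). Pure commutative algebra; no scheme appears.

CONTENT.
* `mk_mem_maximalIdeal_of_mem` — non-units stay non-units in a quotient by a proper ideal.
* `exists_mem_maximalIdeal_forall_dvd_of_dvd_mul` — in a regular local ring `B` of dimension `2` (a UFD, tree `IsRegularLocalRing.uniqueFactorizationMonoid`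
  = Matsumura 20.3) every `b ≠ 0` admits `ℓ ∈ 𝔪_B` COPRIME to it (`b ∣ ℓ a ⇒ b ∣ a`): prime avoidance over the prime factors of `b`, none of which
  generates `𝔪_B` (a principal maximal ideal has height `≤ 1`, Krull).
* `ringKrullDim_quotient_span_singleton_eq` — `dim A ⧸ (g) = 2` for `0 ≠ g ∈ 𝔪` in a regular local `A` of dimension `3`.
* **`exists_isRegular_pair_quotient_span_prime`** — the Cohen–Macaulay clause for `S := A ⧸ (g)`: `[ϖ̄, ℓ̄]` is an `S`-regular sequence in `𝔪_S` of
  length `2 = dim S` (`ϖ̄ ≠ 0` in the domain `S`; `ℓ̄` regular on `S ⧸ ϖ̄ S = (A ⧸ ϖ) ⧸ (ḡ)` by coprimality in the regular surface germ `A ⧸ ϖ`).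
* **`isQuasiRegular_pair_quotient_span_prime`** — HEADLINE: if `(x̄₁, x̄₂) ⊂ S` has maximal radical, `![x̄₁, x̄₂]` is QUASI-REGULAR
  (res-D-pv-003's `isQuasiRegular_of_isSystemOfParameters`, Matsumura 17.4 (iii) + 16.2 (i)) — the `c` of part 2's `hloc`.

References: H. Matsumura, *Commutative Ring Theory* (1986), Thms. 14.2, 16.2, 17.4, 20.3 — through the cited tree files and Mathlib (Krull's height
theorem). OURS planning text (index only): L/w45b/PLANNER-MEMO-g9-1.md v1.1 §1 (c1).
-/

set_option linter.dupNamespace false -- mandated namespace `Summit.<Summit>.<Problem>` of this single-conjunct summit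

noncomputable section

open IsLocalRing RingTheory.Sequence Literature.AlgebraicGeometry.Resolution Literature.RingTheory.TightClosure

namespace Summit.ResolutionOfSingularities.ResolutionOfSingularities.Cruxes.EquisingularLiftNat.Sections

universe u

/-! ## Small local-algebra helpers -/

/-- In a local ring, the class of an element of `𝔪` in a quotient by a proper ideal is not a unit. [folklore] -/
theorem not_isUnit_mk_of_mem_maximalIdeal {A : Type u} [CommRing A] [IsLocalRing A] {I : Ideal A} (hI : I ≠ ⊤) {x : A}
    (hx : x ∈ maximalIdeal A) : ¬ IsUnit (Ideal.Quotient.mk I x) := by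
  intro hu
  obtain ⟨y, hy⟩ := hu.exists_right_inv
  obtain ⟨y, rfl⟩ := Ideal.Quotient.mk_surjective y
  rw [← map_mul, ← map_one (Ideal.Quotient.mk I), Ideal.Quotient.eq] at hy
  have hle : I ≤ maximalIdeal A := IsLocalRing.le_maximalIdeal hI
  have h1 : x * y - 1 ∈ maximalIdeal A := hle hy
  have h2 : x * y ∈ maximalIdeal A := Ideal.mul_mem_right _ _ hx
  have h3 : (1 : A) ∈ maximalIdeal A := by
    have := Ideal.sub_mem _ h2 h1
    rwa [sub_sub_cancel] at this
  exact (maximalIdeal.isMaximal A).ne_top ((Ideal.eq_top_iff_one _).mpr h3)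

/-- `dim (A ⧸ (g)) = 2` for a non-zero `g ∈ 𝔪` of a regular local ring of dimension `3`. [cite: Matsumura1987, Thm. 14.2] -/
theorem ringKrullDim_quotient_span_singleton_eq_two {A : Type u} [CommRing A] [IsRegularLocalRing A]
    (h3 : ringKrullDim A = (3 : ℕ)) {g : A} (hg0 : g ≠ 0) (hgm : g ∈ maximalIdeal A) :
    ringKrullDim (A ⧸ Ideal.span {g}) = (2 : ℕ) := by
  haveI : IsDomain A := isDomain_of_isRegularLocalRing A
  have hreg : IsSMulRegular A g := fun a b hab => mul_left_cancel₀ hg0 hab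
  have h := ringKrullDim_quotient_span_singleton_succ_eq_ringKrullDim hreg hgm
  rw [h3] at h
  have hgu : ¬ IsUnit g := (IsLocalRing.mem_maximalIdeal _).mp hgm
  haveI : Nontrivial (A ⧸ Ideal.span {g}) := Ideal.Quotient.nontrivial_iff.mpr (Ideal.span_singleton_ne_top hgu)
  haveI : IsLocalRing (A ⧸ Ideal.span {g}) := isLocalRing_quotient (Ideal.span_singleton_ne_top hgu)
  obtain ⟨n, hn⟩ := exists_nat_cast_eq_ringKrullDim (R := A ⧸ Ideal.span {g})
  rw [hn] at h ⊢
  have h' : ((n + 1 : ℕ) : WithBot ℕ∞) = ((3 : ℕ) : WithBot ℕ∞) := by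
    rw [← h]; push_cast; rfl
  have h'' : n + 1 = 3 := by exact_mod_cast h'
  have : n = 2 := by omega
  rw [this]

/-- **Coprime elements exist in a regular surface germ.** In a regular local ring `B` of dimension `2` every `b ≠ 0` admits an `ℓ ∈ 𝔪_B`
with `b ∣ ℓ·a ⇒ b ∣ a` for all `a`: `B` is factorial (Matsumura 20.3, tree), the prime factors of `b` generate finitely many prime ideals, none
of them `𝔪_B` (a principal `𝔪_B` has height `≤ 1`), so prime avoidance gives `ℓ`. [cite: Matsumura1987, Thm. 20.3] [OURS · L1 W4.5b] -/
theorem exists_mem_maximalIdeal_forall_dvd_of_dvd_mul {B : Type u} [CommRing B] [IsRegularLocalRing B]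
    (h2 : ringKrullDim B = (2 : ℕ)) {b : B} (hb : b ≠ 0) :
    ∃ ℓ ∈ maximalIdeal B, ∀ a : B, b ∣ ℓ * a → b ∣ a := by
  classical
  haveI : IsDomain B := isDomain_of_isRegularLocalRing B
  haveI : UniqueFactorizationMonoid B := IsRegularLocalRing.uniqueFactorizationMonoid B
  let F : Finset B := (UniqueFactorizationMonoid.factors b).toFinset
  -- `𝔪_B` is not inside the union of the `(p)`, `p` a prime factor of `b`
  have hnot : ¬ ((maximalIdeal B : Set B) ⊆ ⋃ p ∈ (F : Set B), (Ideal.span {p} : Set B)) := by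
    intro hsub
    have hprime : ∀ p ∈ F, p ≠ 0 → p ≠ 0 → (Ideal.span ({p} : Set B)).IsPrime := by
      intro p hp _ _
      have hp' : p ∈ UniqueFactorizationMonoid.factors b := Multiset.mem_toFinset.mp hp
      exact (Ideal.span_singleton_prime (UniqueFactorizationMonoid.prime_of_factor p hp').ne_zero).mpr
        (UniqueFactorizationMonoid.prime_of_factor p hp')
    obtain ⟨p, hp, hle⟩ := (Ideal.subset_union_prime (0 : B) (0 : B) hprime).mp hsub
    have hp' : Prime p := UniqueFactorizationMonoid.prime_of_factor p (Multiset.mem_toFinset.mp hp)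
    have hne : Ideal.span ({p} : Set B) ≠ ⊤ := Ideal.span_singleton_ne_top hp'.not_unit
    have heq : maximalIdeal B = Ideal.span {p} := (maximalIdeal.isMaximal B).eq_of_le hne hle
    have hht : (maximalIdeal B).height ≤ 1 := by
      rw [heq]; exact Ideal.height_span_singleton_le_one hp'.not_unit
    have hht' : ((maximalIdeal B).height : WithBot ℕ∞) ≤ 1 := by exact_mod_cast hht
    rw [IsLocalRing.maximalIdeal_height_eq_ringKrullDim, h2] at hht'
    exact absurd hht' (by decide)
  obtain ⟨ℓ, hℓm, hℓ⟩ := Set.not_subset.mp hnot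
  refine ⟨ℓ, hℓm, fun a hdvd => ?_⟩
  refine UniqueFactorizationMonoid.dvd_of_dvd_mul_right_of_no_prime_factors hb ?_ hdvd
  intro d hdb hdℓ hd
  obtain ⟨q, hq, hdq⟩ := UniqueFactorizationMonoid.exists_mem_factors_of_dvd hb hd.irreducible hdb
  apply hℓ
  simp only [Set.mem_iUnion, SetLike.mem_coe]
  exact ⟨q, Multiset.mem_toFinset.mpr hq, Ideal.mem_span_singleton.mpr (hdq.symm.dvd.trans hdℓ)⟩

/-! ## The Cohen–Macaulay clause of a prime hypersurface in a regular local threefold germ -/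

section Hypersurface

variable {A : Type u} [CommRing A] [IsRegularLocalRing A]

/-- **`[ϖ̄, ℓ̄]` is a regular sequence on `S = A ⧸ (g)`.** `A` regular local of dimension `3`, `ϖ ∈ 𝔪 ∖ 𝔪²` (a regular parameter: the
uniformizer), `g` a PRIME element with `g ∉ (ϖ)`. Then `S := A ⧸ (g)` is a Noetherian local domain of dimension `2` carrying an `S`-regular sequence
of length `2` in `𝔪_S` (the Cohen–Macaulay clause of res-D-pv-003's `isQuasiRegular_of_isSystemOfParameters`).
[cite: Matsumura1987, Thm. 14.2 and Thm. 20.3] [OURS · L1 W4.5b] -/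
theorem exists_isRegular_pair_quotient_span_prime (h3 : ringKrullDim A = (3 : ℕ)) {ϖ g : A} (hϖ : ϖ ∈ maximalIdeal A)
    (hϖ2 : ϖ ∉ maximalIdeal A ^ 2) (hg : Prime g) (hgϖ : g ∉ Ideal.span {ϖ}) :
    letI : IsLocalRing (A ⧸ Ideal.span {g}) := isLocalRing_quotient (Ideal.span_singleton_ne_top hg.not_unit)
    ∃ rs : List (A ⧸ Ideal.span {g}), IsRegular (A ⧸ Ideal.span {g}) rs ∧
      (∀ r ∈ rs, r ∈ maximalIdeal (A ⧸ Ideal.span {g})) ∧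
      (rs.length : WithBot ℕ∞) = ringKrullDim (A ⧸ Ideal.span {g}) := by
  classical
  haveI : IsDomain A := isDomain_of_isRegularLocalRing A
  have hgm : g ∈ maximalIdeal A := (IsLocalRing.mem_maximalIdeal _).mpr hg.not_unit
  have hgtop : Ideal.span {g} ≠ ⊤ := Ideal.span_singleton_ne_top hg.not_unit
  letI : IsLocalRing (A ⧸ Ideal.span {g}) := isLocalRing_quotient hgtop
  haveI : IsDomain (A ⧸ Ideal.span {g}) :=
    (Ideal.Quotient.isDomain_iff_prime _).mpr ((Ideal.span_singleton_prime hg.ne_zero).mpr hg)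
  set S := A ⧸ Ideal.span {g} with hS
  set π := Ideal.Quotient.mk (Ideal.span {g}) with hπ
  -- the regular surface germ `Ā = A ⧸ (ϖ)` and `ḡ ≠ 0` in it
  obtain ⟨hAbar, hdimAbar⟩ := IsRegularLocalRing.quotient_span_singleton hϖ hϖ2
  haveI := hAbar
  set Abar := A ⧸ Ideal.span {ϖ} with hAbardef
  set ρ := Ideal.Quotient.mk (Ideal.span {ϖ}) with hρ
  have h2 : ringKrullDim Abar = (2 : ℕ) := by
    obtain ⟨n, hn⟩ := exists_nat_cast_eq_ringKrullDim (R := Abar)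
    rw [hn, h3] at hdimAbar
    rw [hn]
    have h' : ((n + 1 : ℕ) : WithBot ℕ∞) = ((3 : ℕ) : WithBot ℕ∞) := by
      rw [← hdimAbar]; push_cast; rfl
    have h'' : n + 1 = 3 := by exact_mod_cast h'
    have : n = 2 := by omega
    rw [this]
  have hgbar : ρ g ≠ 0 := fun h => hgϖ (Ideal.Quotient.eq_zero_iff_mem.mp h)
  obtain ⟨ℓbar, hℓbarm, hcop⟩ := exists_mem_maximalIdeal_forall_dvd_of_dvd_mul h2 hgbar
  obtain ⟨ℓ, rfl⟩ := Ideal.Quotient.mk_surjective ℓbar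
  have hℓm : ℓ ∈ maximalIdeal A := by
    by_contra hℓu
    exact ((IsLocalRing.mem_maximalIdeal _).mp hℓbarm) ((IsLocalRing.notMem_maximalIdeal.mp hℓu).map ρ)
  -- `ϖ̄ ≠ 0` in `S`: `ϖ ∈ (g)` would force `g ∈ (ϖ)` (`ϖ ∉ 𝔪²`)
  have hϖS : π ϖ ≠ 0 := by
    intro h
    obtain ⟨c, hc⟩ := Ideal.mem_span_singleton'.mp (Ideal.Quotient.eq_zero_iff_mem.mp h)
    -- `ϖ = c * g`; `c` is a unit since `ϖ ∉ 𝔪²`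
    have hcu : IsUnit c := by
      by_contra hcu
      have hcm : c ∈ maximalIdeal A := (IsLocalRing.mem_maximalIdeal _).mpr hcu
      apply hϖ2
      rw [← hc, pow_two]
      exact Ideal.mul_mem_mul hcm hgm
    apply hgϖ
    obtain ⟨u, rfl⟩ := hcu
    exact Ideal.mem_span_singleton'.mpr ⟨↑u⁻¹, by rw [← hc, ← mul_assoc, Units.inv_mul, one_mul]⟩
  have hreg1 : IsSMulRegular S (π ϖ) := fun a b hab => mul_left_cancel₀ hϖS hab
  -- `ℓ̄` is regular on `S ⧸ ϖ̄ S`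
  have hreg2 : IsSMulRegular (QuotSMulTop (π ϖ) S) (π ℓ) := by
    refine IsSMulRegular.of_right_eq_zero_of_smul fun m hm => ?_
    obtain ⟨s, rfl⟩ := Submodule.Quotient.mk_surjective _ m
    obtain ⟨s, rfl⟩ := Ideal.Quotient.mk_surjective s
    rw [← Submodule.Quotient.mk_smul, Submodule.Quotient.mk_eq_zero, Submodule.mem_smul_pointwise_iff_exists] at hm
    obtain ⟨u, -, hu⟩ := hm
    obtain ⟨u, rfl⟩ := Ideal.Quotient.mk_surjective u
    -- `ℓ s - ϖ u ∈ (g)`: `ℓ s = ϖ u + v g`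
    have h1 : π (ℓ * s - ϖ * u) = 0 := by
      rw [map_sub, map_mul, map_mul]
      change π ℓ * π s - π ϖ * π u = 0
      rw [← smul_eq_mul (π ℓ) (π s), ← hu, smul_eq_mul, sub_self]
    obtain ⟨v, hv⟩ := Ideal.mem_span_singleton'.mp (Ideal.Quotient.eq_zero_iff_mem.mp h1)
    -- in `Ā`: `ḡ ∣ ℓ̄ s̄`, hence `ḡ ∣ s̄`
    have hdvd : ρ g ∣ ρ ℓ * ρ s := by
      refine ⟨ρ v, ?_⟩
      have : ρ (ℓ * s) = ρ (ϖ * u) + ρ (v * g) := by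
        rw [← map_add]; congr 1; rw [hv]; ring
      rw [map_mul] at this
      rw [this, map_mul, map_mul, Ideal.Quotient.eq_zero_iff_mem.mpr (Ideal.mem_span_singleton_self ϖ), zero_mul, zero_add,
        mul_comm]
    obtain ⟨w, hw⟩ := hcop _ hdvd
    obtain ⟨w, rfl⟩ := Ideal.Quotient.mk_surjective w
    -- `s - g w ∈ (ϖ)`: `s = g w + ϖ t`
    have h2' : ρ (s - g * w) = 0 := by rw [map_sub, map_mul, hw, sub_self]
    obtain ⟨t, ht⟩ := Ideal.mem_span_singleton'.mp (Ideal.Quotient.eq_zero_iff_mem.mp h2')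
    -- so `s̄ = ϖ̄ · t̄` in `S`
    rw [Submodule.Quotient.mk_eq_zero, Submodule.mem_smul_pointwise_iff_exists]
    refine ⟨π t, Submodule.mem_top, ?_⟩
    rw [smul_eq_mul, ← map_mul, Ideal.Quotient.eq, mul_comm]
    refine Ideal.mem_span_singleton'.mpr ⟨-w, ?_⟩
    have : t * ϖ = s - g * w := ht
    rw [this]; ring
  -- assemble
  have hmem : ∀ r ∈ [π ϖ, π ℓ], r ∈ maximalIdeal S := by
    intro r hr
    simp only [List.mem_cons, List.mem_nil_iff, or_false] at hr
    rcases hr with rfl | rfl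
    · exact (IsLocalRing.mem_maximalIdeal _).mpr (not_isUnit_mk_of_mem_maximalIdeal hgtop hϖ)
    · exact (IsLocalRing.mem_maximalIdeal _).mpr (not_isUnit_mk_of_mem_maximalIdeal hgtop hℓm)
  have hweak : IsWeaklyRegular S [π ϖ, π ℓ] := by
    rw [isWeaklyRegular_cons_iff, isWeaklyRegular_singleton_iff]
    exact ⟨hreg1, hreg2⟩
  refine ⟨[π ϖ, π ℓ], IsRegular.of_isWeaklyRegular_of_mem_maximalIdeal S hmem hweak, hmem, ?_⟩
  rw [ringKrullDim_quotient_span_singleton_eq_two h3 hg.ne_zero hgm]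
  rfl

/-- **E-NEG(1) part 3a, HEADLINE — an `𝔪`-primary pair in a prime hypersurface of a regular local threefold germ is QUASI-REGULAR.**
`A` regular local of dimension `3`, `ϖ ∈ 𝔪 ∖ 𝔪²`, `g` prime with `g ∉ (ϖ)`, and `x₁, x₂ ∈ A` whose classes generate an ideal of `S = A ⧸ (g)`
with MAXIMAL radical («`s(η) ∉ D♭`»). Then `![x̄₁, x̄₂]` is a quasi-regular sequence of `S` — the local input `c` of part 2's
`range_subset_image_support_of_exactShadow` (with `hc` supplied by the frame dictionary). [cite: Matsumura1987, Thm. 17.4 (iii), Thm. 16.2 (i)]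
[OURS · L1 W4.5b] -/
theorem isQuasiRegular_pair_quotient_span_prime (h3 : ringKrullDim A = (3 : ℕ)) {ϖ g : A} (hϖ : ϖ ∈ maximalIdeal A)
    (hϖ2 : ϖ ∉ maximalIdeal A ^ 2) (hg : Prime g) (hgϖ : g ∉ Ideal.span {ϖ}) (x₁ x₂ : A)
    (hrad : (Ideal.span {Ideal.Quotient.mk (Ideal.span {g}) x₁, Ideal.Quotient.mk (Ideal.span {g}) x₂}).radical.IsMaximal) :
    IsQuasiRegular ![Ideal.Quotient.mk (Ideal.span {g}) x₁, Ideal.Quotient.mk (Ideal.span {g}) x₂] := by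
  have hgm : g ∈ maximalIdeal A := (IsLocalRing.mem_maximalIdeal _).mpr hg.not_unit
  letI : IsLocalRing (A ⧸ Ideal.span {g}) := isLocalRing_quotient (Ideal.span_singleton_ne_top hg.not_unit)
  have hCM := exists_isRegular_pair_quotient_span_prime h3 hϖ hϖ2 hg hgϖ
  refine isQuasiRegular_of_isSystemOfParameters hCM _ (isSystemOfParameters_iff.mpr ⟨?_, ?_⟩)
  · exact ringKrullDim_quotient_span_singleton_eq_two h3 hg.ne_zero hgm
  · have hr : Set.range ![Ideal.Quotient.mk (Ideal.span {g}) x₁, Ideal.Quotient.mk (Ideal.span {g}) x₂] =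
        {Ideal.Quotient.mk (Ideal.span {g}) x₁, Ideal.Quotient.mk (Ideal.span {g}) x₂} := by
      rw [Matrix.range_cons, Matrix.range_cons, Matrix.range_empty, Set.union_empty]; rfl
    rw [hr]; exact hrad

end Hypersurface

end Summit.ResolutionOfSingularities.ResolutionOfSingularities.Cruxes.EquisingularLiftNat.Sections

end
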